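import Mathlib
import HarnessLib
import Literature.Analysis.FluidPDE.SelfSimilar
import Literature.Analysis.FluidPDE.LocalTypeI
import Literature.Analysis.FluidPDE.VectorCalculus
import Literature.Analysis.FluidPDE.IsometryInvariance
import Literature.Analysis.FluidPDE.OseenZoomCovariance
import Literature.Analysis.FluidPDE.CurlIsometryCovariance
import Literature.Analysis.UnboundedOperators.HeatKernel
import Summits.NavierStokesRegularity.NavierStokesRegularity.Theorems.RellichScarSimilarityCovarianceRotationTypeI

/-!
# Route `PoloidalWindowDoor` (staged, nsreg-p1), crux `PoloidalWindowRigidity` — stub `stub_rotate`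
# of the five-stub birth skeleton (`route-poloidal/bc/PoloidalWindowRigidity_birth.lean`)

Cell ns-regularity-ideate, seat p6 (route-directed support; land `--supports <PoloidalWindowRigidity item>`
once the route is born — the statement below is VERBATIM the registered stub signature, in tree vocabulary only).

`stub_rotate` — **rotation covariance of the route's Type-I profile class: WLOG `e = e₃`.** If
`v : (−∞,0) × ℝ³ → ℝ³` has the Type-I time rate with constant `C`, is continuous on the open lower slab,
satisfies the unit-viscosity Oseen–Duhamel identity between negative times, has divergence-free slices, every
vorticity slice is orthogonal to a fixed `e ≠ 0` (`⟪curl v(s,y), e⟫ = 0`), and the apex `(0,0)` is a backward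
singular point, then the conjugated profile `v'(t,x) = R v(t, R⁻¹x)` — `R` the reflection of `ℝ³` exchanging
`e₃` and `e/‖e‖` — has all the same properties with `e` replaced by `e₃ = EuclideanSpace.single 2 1` (and the
same constant `C`). Ingredients (all tree theorems): `heatExtension_conj_linearIsometryEquiv`,
`oseenDuhamel_symm_conj_linearIsometryEquiv` (`OseenZoomCovariance`), `IsDivFree.conj_linearIsometryEquiv`
(`IsometryInvariance`), the pseudovector law of the curl `inner_curl_conj_linearIsometryEquiv_eq_zero_iff`
(`CurlIsometryCovariance`), and `RellichScarSimilarityCovariance.isBackwardSingularPoint_zero_conj`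
(the origin stays backward-singular under a linear isometry).

WHAT THIS IS NOT: not a claim about Navier–Stokes regularity; a support lemma for a STAGED door route
(bears_on LADDER-NS N0, rung N0-LocalTubeDoorPoloidal).
-/

noncomputable section

-- the summit and its single sub-problem share the name (CONVENTIONS §1), as in every Theorems file
set_option linter.dupNamespace false

namespace Summit.NavierStokesRegularity.NavierStokesRegularity.Theorems.PoloidalWindowDoorPoloidalWindowRigidityRotate

open MeasureTheory Set Function Filter Topology TopologicalSpace Metric
open scoped RealInnerProductSpace InnerProductSpace
open Literature.Analysis Literature.Analysis.FluidPDE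
open Summit.NavierStokesRegularity.NavierStokesRegularity.Theorems.RellichScarSimilarityCovariance

variable {C : ℝ} {v : ℝ → EuclideanSpace ℝ (Fin 3) → EuclideanSpace ℝ (Fin 3)}

/-- **Transport of the route's profile class under a linear isometry** `L` of `ℝ³`: the conjugated field
`v'(t,x) = L v(t, L⁻¹x)` keeps the Type-I time rate (same constant), continuity on the open lower slab, the
unit-viscosity Oseen–Duhamel identity between negative times and divergence-free slices. -/
theorem class_conj_linearIsometryEquiv (L : EuclideanSpace ℝ (Fin 3) ≃ₗᵢ[ℝ] EuclideanSpace ℝ (Fin 3))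
    (hrate : HasTypeITimeDecay C v) (hcont : ContinuousOn (uncurry v) (Iio (0 : ℝ) ×ˢ univ))
    (hmild : ∀ s t : ℝ, s < t → t < 0 → ∀ x,
      v t x = UnboundedOperators.heatExtension (v s) (t - s) x - oseenDuhamel 1 s v v t x)
    (hdiv : ∀ t < 0, VectorCalculus.IsDivFree (v t)) :
    HasTypeITimeDecay C (fun t x => L (v t (L.symm x))) ∧
    ContinuousOn (uncurry fun t x => L (v t (L.symm x))) (Iio (0 : ℝ) ×ˢ univ) ∧
    (∀ s t : ℝ, s < t → t < 0 → ∀ x, (fun t x => L (v t (L.symm x))) t x =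
      UnboundedOperators.heatExtension ((fun t x => L (v t (L.symm x))) s) (t - s) x -
        oseenDuhamel 1 s (fun t x => L (v t (L.symm x))) (fun t x => L (v t (L.symm x))) t x) ∧
    (∀ t < 0, VectorCalculus.IsDivFree ((fun t x => L (v t (L.symm x))) t)) := by
  refine ⟨fun t ht x => ?_, ?_, fun s t hst ht0 x => ?_, fun t ht => (hdiv t ht).conj_linearIsometryEquiv L⟩
  · -- (a) the rate (`‖L a‖ = ‖a‖`)
    dsimp only
    rw [L.norm_map]
    exact hrate t ht (L.symm x)
  · -- (b) continuity on the slab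
    have h1 : ContinuousOn (fun p : ℝ × EuclideanSpace ℝ (Fin 3) => (p.1, L.symm p.2))
        (Iio (0 : ℝ) ×ˢ univ) :=
      (continuous_fst.prodMk (L.symm.continuous.comp continuous_snd)).continuousOn
    have h2 : MapsTo (fun p : ℝ × EuclideanSpace ℝ (Fin 3) => (p.1, L.symm p.2))
        (Iio (0 : ℝ) ×ˢ univ) (Iio 0 ×ˢ univ) :=
      fun p hp => mem_prod.2 ⟨(mem_prod.1 hp).1, mem_univ _⟩
    exact L.continuous.comp_continuousOn (hcont.comp h1 h2)
  · -- (c) the Oseen identity, by covariance of the caloric extension and of the Duhamel term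
    have h1 : UnboundedOperators.heatExtension (fun y => L (v s (L.symm y))) (t - s) x =
        L (UnboundedOperators.heatExtension (v s) (t - s) (L.symm x)) :=
      heatExtension_conj_linearIsometryEquiv L (v s) (t - s) x
    have h2 := oseenDuhamel_symm_conj_linearIsometryEquiv L.symm 1 s v v t x
    simp only [LinearIsometryEquiv.symm_symm] at h2
    have h3 := hmild s t hst ht0 (L.symm x)
    show L (v t (L.symm x)) = _
    rw [h1, h2, h3, map_sub]

/-- The unit vector along `e ≠ 0` and the reflection `R` of `ℝ³` with `R e₃ = e/‖e‖` (hence `R⁻¹ = R` and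
`R (e/‖e‖) = e₃`): existence of a linear isometry `L` with `L⁻¹ e₃ = ‖e‖⁻¹ • e`. -/
theorem exists_linearIsometryEquiv_symm_single_two {e : EuclideanSpace ℝ (Fin 3)} (he : e ≠ 0) :
    ∃ L : EuclideanSpace ℝ (Fin 3) ≃ₗᵢ[ℝ] EuclideanSpace ℝ (Fin 3),
      L.symm (EuclideanSpace.single 2 1) = (‖e‖⁻¹ : ℝ) • e := by
  set ehat : EuclideanSpace ℝ (Fin 3) := (‖e‖⁻¹ : ℝ) • e with hehat
  have hehat1 : ‖ehat‖ = 1 := norm_smul_inv_norm he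
  have he2 : ‖(EuclideanSpace.single (2 : Fin 3) (1 : ℝ) : EuclideanSpace ℝ (Fin 3))‖ = ‖ehat‖ := by
    rw [EuclideanSpace.single, PiLp.norm_single, norm_one, hehat1]
  set R : EuclideanSpace ℝ (Fin 3) ≃ₗᵢ[ℝ] EuclideanSpace ℝ (Fin 3) :=
    Submodule.reflection (ℝ ∙ (EuclideanSpace.single (2 : Fin 3) (1 : ℝ) - ehat))ᗮ with hR
  have hRe : R (EuclideanSpace.single (2 : Fin 3) (1 : ℝ)) = ehat := Submodule.reflection_sub he2
  exact ⟨R.symm, by rw [LinearIsometryEquiv.symm_symm, hRe]⟩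

/-- **Stub `stub_rotate` of the PoloidalWindowRigidity birth skeleton** (VERBATIM signature): WLOG `e = e₃` —
the route's Type-I profile class, the poloidal condition `⟪curl v(s), e⟫ ≡ 0` and the backward-singular apex
are transported by the linear isometry `L` of `ℝ³` with `L⁻¹ e₃ = e/‖e‖` to the conjugated profile
`v'(t,x) = L v(t, L⁻¹x)`, for which `⟪curl v'(s), e₃⟫ ≡ 0` by the pseudovector law of the curl
(`curl v'(s)(x) = det L • L curl v(s)(L⁻¹x)`, `det L = ±1`). -/
theorem stub_rotate :
    ∀ (C : ℝ) (v : ℝ → EuclideanSpace ℝ (Fin 3) → EuclideanSpace ℝ (Fin 3)),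
    Literature.Analysis.FluidPDE.HasTypeITimeDecay C v →
    ContinuousOn (Function.uncurry v) (Set.Iio (0 : ℝ) ×ˢ Set.univ) →
    (∀ s t : ℝ, s < t → t < 0 → ∀ x, v t x =
      Literature.Analysis.UnboundedOperators.heatExtension (v s) (t - s) x -
        Literature.Analysis.FluidPDE.oseenDuhamel 1 s v v t x) →
    (∀ t < 0, Literature.Analysis.FluidPDE.VectorCalculus.IsDivFree (v t)) →
    ∀ (e : EuclideanSpace ℝ (Fin 3)), e ≠ 0 → (∀ s < 0, ∀ y, ⟪Literature.Analysis.FluidPDE.curl (v s) y, e⟫_ℝ = 0) →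
    Literature.Analysis.FluidPDE.IsBackwardSingularPoint v 0 →
    ∃ (C' : ℝ) (v' : ℝ → EuclideanSpace ℝ (Fin 3) → EuclideanSpace ℝ (Fin 3)),
      Literature.Analysis.FluidPDE.HasTypeITimeDecay C' v' ∧
      ContinuousOn (Function.uncurry v') (Set.Iio (0 : ℝ) ×ˢ Set.univ) ∧
      (∀ s t : ℝ, s < t → t < 0 → ∀ x, v' t x =
        Literature.Analysis.UnboundedOperators.heatExtension (v' s) (t - s) x -
          Literature.Analysis.FluidPDE.oseenDuhamel 1 s v' v' t x) ∧
      (∀ t < 0, Literature.Analysis.FluidPDE.VectorCalculus.IsDivFree (v' t)) ∧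
      (∀ s < 0, ∀ y, ⟪Literature.Analysis.FluidPDE.curl (v' s) y, EuclideanSpace.single 2 1⟫_ℝ = 0) ∧
      Literature.Analysis.FluidPDE.IsBackwardSingularPoint v' 0 := by
  intro C v hrate hcont hmild hdiv e he hpol hsing
  obtain ⟨L, hL⟩ := exists_linearIsometryEquiv_symm_single_two he
  obtain ⟨hrate', hcont', hmild', hdiv'⟩ := class_conj_linearIsometryEquiv L hrate hcont hmild hdiv
  refine ⟨C, fun t x => L (v t (L.symm x)), hrate', hcont', hmild', hdiv', fun s hs y => ?_,
    isBackwardSingularPoint_zero_conj L hsing⟩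
  -- the pseudovector law: `⟪curl v'(s)(y), e₃⟫ = 0 ↔ ⟪curl v(s)(L⁻¹y), L⁻¹e₃⟫ = 0`, and `L⁻¹e₃ = e/‖e‖`
  have h := (inner_curl_conj_linearIsometryEquiv_eq_zero_iff L (v s) y (EuclideanSpace.single 2 1)).2
  refine h ?_
  rw [hL, inner_smul_right, hpol s hs (L.symm y), mul_zero]

end Summit.NavierStokesRegularity.NavierStokesRegularity.Theorems.PoloidalWindowDoorPoloidalWindowRigidityRotate

end
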